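import Mathlib
import Literature.NumberTheory.LFunctions.Zhang2022.TypedSection16A
import Literature.NumberTheory.LFunctions.Zhang2022.TypedSection16B
import Literature.NumberTheory.LFunctions.Zhang2022.AppendixAEulerFactorM2
import Literature.NumberTheory.LFunctions.Zhang2022.AppendixALemma161
import Literature.NumberTheory.LFunctions.Zhang2022.AppendixALemma161Bridge

/-!
# Zhang (2022) Lemma 16.1 is a theorem: `𝔪₂*(s) = 𝔭 + O(𝓛⁻⁸)` for `|s − 1| < 5α`, kernel-checked

Topic `Literature/NumberTheory/LFunctions/Zhang2022` (Landau–Siegel audit tree; verdict-neutral).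
Y. Zhang, *Discrete mean estimates and the Landau–Siegel zero*, arXiv:2211.02515v1 (2022)
[Zhang2022LandauSiegel] — **an unrefereed manuscript under adjudication**; this file PROVES the
manuscript's Lemma 16.1 [Z22 p. 92, tex L4579–4590] about the campaign's typed objects (L4-t4's
`Typed.Section16A.calM2star` = `𝔪₂*(s)`, L4-t5's `Typed.Section16B.frakp` = `𝔭`), following its
Appendix-A proof [Z22 p. 105, tex L5194–5224], and asserts nothing else about the manuscript's theorems.
Campaign D-0069, DAG nodes `Z22:Lem16.1`, `Z22:§16.u027`, `Z22:Lem16.1.pf` — DISCHARGED (modulo the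
shape of the typed node `Lemma161`, see below); consumer: `Skeleton.Ded1617` (§16 chain, seat sz-d49).

* `norm_calM2star_sub_frakp_le c′ : ∃ C, ∀ D ≥ ⌈e³⌉, ∀ χ (mod D), ∀ s, |s − 1| < 5α →
  ‖calM2star c′ χ s − frakp χ‖ ≤ C·𝓛⁻⁸` — for EVERY Dirichlet character; Assumption (A), reality,
  primitivity and the printed (idle) hypothesis `dl < PT⁻²` are not used; the constant depends on `c′`
  only through `|b₁| ≤ (1 + |c′|/2)α`. In fact the proof gives `O_{c′}(α) + O(D^{−4/5})`, one
  logarithm better than printed.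
* `lemma161_calM2star c′` — the same in the `ForAllLarge`/(A)/`d,l` clothing of the typed node
  `Typed.Section16B.Lemma161 c′` with `𝔪₂* := calM2star` (L4-t5's announced merge revision; the
  pre-merge `m2Star` is built on the analytic-continuation device `acVal` and is NOT addressed here).

Proof route (all kernel-checked in the companions): closed forms of `κ₂(qʲ)`, `κ̃₂(qʳ;1)`, `ξ₂(qʳ;1,1)`,
`Σ_r ξ₂q^{−rs}`, `λ₂(q)` ⇒ the Euler factor `F_q(s)` is an explicit rational function of `χ(q)`,
`q^{−β₁}`, `q^{−s}` (`AppendixAKappa2PrimePowers`, `AppendixAEulerFactorM2`, `AppendixALemma161Bridge`);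
`|F_q − M_q| ≤ 150(|b₁| + 2|s−1|)log q/q²` (`q ≤ D`), `|F_q − 1| ≤ 225q^{−1−σ}`, `|M_q − 1| ≤ 4/q²`;
product bookkeeping over the primes (`AppendixAPrimeProducts`) ⇒ `‖∏F_q − ∏M_q‖ ≤ K(150(|b₁|+2|s−1|)
+ D^{−4/5})` (`AppendixALemma161`); `α = π𝓛⁻⁹`, `D^{−4/5} ≤ (8!/(4/5)⁸)𝓛⁻⁸`.

## References
* Y. Zhang, arXiv:2211.02515v1 (2022), §16 Lemma 16.1 p. 92, Appendix A p. 105.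
  [cite: Zhang2022LandauSiegel, §16 Lemma 16.1, App. A]
-/

noncomputable section

open Complex Real Finset Filter Topology

namespace Literature.NumberTheory.LFunctions.Zhang2022.AppendixA

open MeanSquareMajorant

/-! ## §6. Lemma 16.1 for the typed objects: `‖𝔪₂*(s) − 𝔭‖ ≤ C𝓛⁻⁸` for `|s − 1| < 5α` -/

section LemmaSixteenOne

open Literature.NumberTheory.LFunctions.Zhang2022.Typed

/-- `log D ≥ 3` once `D ≥ ⌈e³⌉`. [cite: Zhang2022LandauSiegel, §2 (2.1)] -/
private theorem three_le_ell {D : ℕ} (hD : ⌈Real.exp 3⌉₊ ≤ D) : 3 ≤ Skeleton.ell D := by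
  have h : Real.exp 3 ≤ D := le_trans (Nat.le_ceil _) (by exact_mod_cast hD)
  exact (Real.le_log_iff_exp_le (lt_of_lt_of_le (Real.exp_pos _) h)).mpr h

/-- `α = π/𝓛⁹` ((2.10) with `log P = 𝓛⁹`, (2.6)). [cite: Zhang2022LandauSiegel, §2 (2.10)] -/
private theorem alpha_eq (D : ℕ) : Skeleton.alpha D = π / Skeleton.ell D ^ 9 := by
  unfold Skeleton.alpha Skeleton.bigP; rw [Real.log_exp]

/-- `D^{−4/5} ≤ (8!/(4/5)⁸)·𝓛⁻⁸` (`D ≥ 1`): from `x⁸/8! ≤ eˣ` at `x = (4/5)log D`.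
[cite: Zhang2022LandauSiegel, §16 Lemma 16.1 p. 92] -/
private theorem rpow_neg_four_fifths_le {D : ℕ} (hD : 1 ≤ D) (hℓ : 0 < Skeleton.ell D) :
    (D : ℝ) ^ (-(4 / 5 : ℝ)) ≤ ((Nat.factorial 8 : ℝ) / (4 / 5) ^ 8) * (Skeleton.ell D ^ 8)⁻¹ := by
  have hD0 : (0 : ℝ) < D := by exact_mod_cast hD
  have hx : 0 ≤ (4 / 5 : ℝ) * Skeleton.ell D := by positivity
  have h := Real.pow_div_factorial_le_exp _ hx 8
  have hexp : Real.exp ((4 / 5 : ℝ) * Skeleton.ell D) = (D : ℝ) ^ (4 / 5 : ℝ) := by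
    rw [Skeleton.ell, Real.rpow_def_of_pos hD0, mul_comm]
  rw [hexp, mul_pow, div_le_iff₀ (by positivity)] at h
  rw [Real.rpow_neg hD0.le]
  have h8 : (0 : ℝ) < (Nat.factorial 8 : ℝ) := by positivity
  have hl8 : 0 < Skeleton.ell D ^ 8 := by positivity
  rw [inv_le_iff_one_le_mul₀ (by positivity)]
  calc (1 : ℝ) = (Skeleton.ell D ^ 8)⁻¹ * Skeleton.ell D ^ 8 := by field_simp
    _ ≤ (Skeleton.ell D ^ 8)⁻¹ * ((Nat.factorial 8 : ℝ) / (4 / 5) ^ 8 * (D : ℝ) ^ (4 / 5 : ℝ)) := by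
        gcongr
        rw [div_mul_eq_mul_div, le_div_iff₀ (by positivity)]
        linarith
    _ = (Nat.factorial 8 : ℝ) / (4 / 5) ^ 8 * (Skeleton.ell D ^ 8)⁻¹ * (D : ℝ) ^ (4 / 5 : ℝ) := by ring

/-- **Lemma 16.1 for the typed objects of §16** (the manuscript's Lemma 16.1, §16 p. 92 with its
Appendix-A proof p. 105, as a THEOREM about L4-t4's `calM2star` and L4-t5's `frakp`): there is `C = C(c′)`
such that for every `D ≥ ⌈e³⌉`, every Dirichlet character `χ (mod D)` and every `s` with `|s − 1| < 5α`,
`‖𝔪₂*(s) − 𝔭‖ ≤ C·𝓛⁻⁸`. Assumption (A), primitivity/reality of `χ` and the printed (idle) hypothesis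
`dl < PT⁻²` are not needed. [cite: Zhang2022LandauSiegel, §16 Lemma 16.1 p. 92, App. A p. 105] -/
theorem norm_calM2star_sub_frakp_le (c' : ℝ) : ∃ C : ℝ, ∀ (D : ℕ) (χ : DirichletCharacter ℂ D),
    ⌈Real.exp 3⌉₊ ≤ D → ∀ s : ℂ, ‖s - 1‖ < 5 * Skeleton.alpha D →
      ‖Section16A.calM2star c' χ s - Section16B.frakp χ‖ ≤ C * (Skeleton.ell D ^ 8)⁻¹ := by
  obtain ⟨K, hK, hmodel⟩ := model_lemma161
  set C8 : ℝ := (Nat.factorial 8 : ℝ) / (4 / 5) ^ 8 with hC8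
  refine ⟨2 * K * ((1650 + 75 * |c'|) * π + C8), fun D χ hD s hs => ?_⟩
  -- the parameters at `D ≥ e³`
  have hℓ3 : 3 ≤ Skeleton.ell D := three_le_ell hD
  have hℓ0 : 0 < Skeleton.ell D := by linarith
  have hD3 : 3 ≤ D := by
    have : (3 : ℝ) ≤ Real.exp 3 := by
      have := Real.add_one_le_exp (3 : ℝ); linarith
    have h2 : Real.exp 3 ≤ D := le_trans (Nat.le_ceil _) (by exact_mod_cast hD)
    exact_mod_cast this.trans h2
  have hα := alpha_eq D
  have hα0 : 0 ≤ Skeleton.alpha D := by rw [hα]; positivity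
  have hℓ9 : (3 : ℝ) ^ 9 ≤ Skeleton.ell D ^ 9 := by gcongr
  have hℓ8 : (3 : ℝ) ^ 8 ≤ Skeleton.ell D ^ 8 := by gcongr
  have hπ4 : π ≤ 4 := Real.pi_le_four
  have hα50 : Skeleton.alpha D ≤ 1 / 50 := by
    rw [hα, div_le_iff₀ (by positivity)]; nlinarith
  have hαℓ : Skeleton.alpha D * Skeleton.ell D ≤ 1 / 10 := by
    rw [hα, div_mul_eq_mul_div, div_le_iff₀ (by positivity)]
    have : π * Skeleton.ell D * 10 ≤ 40 * Skeleton.ell D := by nlinarith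
    nlinarith [pow_le_pow_left₀ (by norm_num : (0:ℝ) ≤ 3) hℓ3 8,
      mul_le_mul_of_nonneg_left hℓ8 (show (0:ℝ) ≤ Skeleton.ell D by linarith)]
  have hαℓ8 : Skeleton.alpha D ≤ π * (Skeleton.ell D ^ 8)⁻¹ := by
    rw [hα, div_eq_mul_inv]
    have h89 : Skeleton.ell D ^ 8 ≤ Skeleton.ell D ^ 9 :=
      pow_le_pow_right₀ (by linarith : (1 : ℝ) ≤ Skeleton.ell D) (by norm_num)
    exact mul_le_mul_of_nonneg_left (inv_anti₀ (by positivity) h89) Real.pi_pos.le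
  -- `|b₁| ≤ (1 + |c′|/2)α`
  have hb1 : |Skeleton.b1 c' D| ≤ (1 + |c'| / 2) * Skeleton.alpha D := by
    unfold Skeleton.b1
    rw [abs_mul, abs_of_nonneg hα0, mul_comm]
    gcongr
    calc |1 - 5 * c' * Skeleton.alpha D * Skeleton.ell D|
        ≤ |(1 : ℝ)| + |5 * c' * Skeleton.alpha D * Skeleton.ell D| := abs_sub _ _
      _ = 1 + 5 * |c'| * (Skeleton.alpha D * Skeleton.ell D) := by
          rw [abs_one, abs_mul, abs_mul, abs_mul, abs_of_nonneg hα0, abs_of_nonneg hℓ0.le,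
            abs_of_nonneg (by norm_num : (0:ℝ) ≤ 5)]; ring
      _ ≤ 1 + 5 * |c'| * (1 / 10) := by gcongr
      _ = 1 + |c'| / 2 := by ring
  have hD45 := rpow_neg_four_fifths_le (D := D) (by omega) hℓ0
  -- the common bound for either pair of products
  have hB : K * (150 * (|Skeleton.b1 c' D| + 2 * ‖s - 1‖) + (D : ℝ) ^ (-(4 / 5 : ℝ))) ≤
      K * ((1650 + 75 * |c'|) * π + C8) * (Skeleton.ell D ^ 8)⁻¹ := by
    have h1 : 150 * (|Skeleton.b1 c' D| + 2 * ‖s - 1‖) ≤ (1650 + 75 * |c'|) * Skeleton.alpha D := by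
      nlinarith [abs_nonneg c', hs.le]
    have h2 : (1650 + 75 * |c'|) * Skeleton.alpha D ≤
        (1650 + 75 * |c'|) * π * (Skeleton.ell D ^ 8)⁻¹ := by
      rw [mul_assoc]; gcongr
    rw [mul_assoc K]
    gcongr
    calc 150 * (|Skeleton.b1 c' D| + 2 * ‖s - 1‖) + (D : ℝ) ^ (-(4 / 5 : ℝ))
        ≤ (1650 + 75 * |c'|) * π * (Skeleton.ell D ^ 8)⁻¹ + C8 * (Skeleton.ell D ^ 8)⁻¹ :=
          add_le_add (h1.trans h2) hD45
      _ = ((1650 + 75 * |c'|) * π + C8) * (Skeleton.ell D ^ 8)⁻¹ := by ring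
  -- `σ ≥ 9/10`, so every `‖q^{−s}‖ ≤ 3/5 < 1`
  have hσ : 9 / 10 ≤ s.re := by
    have h := Complex.abs_re_le_norm (s - 1)
    rw [Complex.sub_re, Complex.one_re] at h
    have := (abs_le.mp (h.trans (by linarith : ‖s - 1‖ ≤ 1 / 10))).1
    linarith
  have hxq : ∀ q : Nat.Primes, ‖((q : ℕ) : ℂ) ^ (-s)‖ < 1 := fun q =>
    lt_of_le_of_lt (norm_cpow_neg_le_three_fifths q.prop.two_le hσ).2 (by norm_num)
  have eF : ∀ q : Nat.Primes, Section16A.calM2Factor c' χ (q : ℕ) 1 1 s =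
      locF (χ ((q : ℕ) : ZMod D)) (((q : ℕ) : ℂ) ^ (-Skeleton.beta1 c' D)) (((q : ℕ) : ℂ) ^ (-s)) q :=
    fun q => calM2Factor_prime_one_one c' χ q.prop s (hxq q)
  have eM : ∀ q : Nat.Primes, Section16B.frakpFactor χ (q : ℕ) = locMain (χ ((q : ℕ) : ZMod D)) q :=
    fun q => frakpFactor_eq_locMain χ q
  have hKpos : 0 ≤ K * ((1650 + 75 * |c'|) * π + C8) * (Skeleton.ell D ^ 8)⁻¹ := by positivity
  by_cases h2 : χ (2 : ZMod D) ≠ 1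
  · -- `χ(2) ≠ 1`: `𝔪₂* = 𝔪₂(1,1;s) = ∏'_q F_q(s)`, `𝔭 = ∏'_q M_q`
    have hm := hmodel c' D χ (fun _ => False) (by omega) hα50 hαℓ s hs
    simp only [if_false] at hm
    have e1 : Section16A.calM2star c' χ s = ∏' q : Nat.Primes,
        locF (χ ((q : ℕ) : ZMod D)) (((q : ℕ) : ℂ) ^ (-Skeleton.beta1 c' D)) (((q : ℕ) : ℂ) ^ (-s)) q := by
      rw [Section16A.calM2star, if_pos h2, Section16A.calM2]
      exact tprod_congr eF
    have e2 : Section16B.frakp χ = ∏' q : Nat.Primes, locMain (χ ((q : ℕ) : ZMod D)) q := by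
      rw [Section16B.frakp, if_pos h2, Section16B.frakpA]
      exact tprod_congr eM
    rw [e1, e2]
    calc _ ≤ K * (150 * (|Skeleton.b1 c' D| + 2 * ‖s - 1‖) + (D : ℝ) ^ (-(4 / 5 : ℝ))) := hm
      _ ≤ K * ((1650 + 75 * |c'|) * π + C8) * (Skeleton.ell D ^ 8)⁻¹ := hB
      _ ≤ 2 * K * ((1650 + 75 * |c'|) * π + C8) * (Skeleton.ell D ^ 8)⁻¹ := by nlinarith
  · -- `χ(2) = 1`: both products skip the prime `2` and carry the factor `2`
    have hm := hmodel c' D χ (fun q => q = 2) (by omega) hα50 hαℓ s hs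
    have e1 : Section16A.calM2star c' χ s = 2 * ∏' q : Nat.Primes, if (q : ℕ) = 2 then (1 : ℂ) else
        locF (χ ((q : ℕ) : ZMod D)) (((q : ℕ) : ℂ) ^ (-Skeleton.beta1 c' D)) (((q : ℕ) : ℂ) ^ (-s)) q := by
      rw [Section16A.calM2star, if_neg h2]
      congr 1
      exact tprod_congr fun q => by rw [eF q]
    have e2 : Section16B.frakp χ = 2 * ∏' q : Nat.Primes, if (q : ℕ) = 2 then (1 : ℂ) else
        locMain (χ ((q : ℕ) : ZMod D)) q := by
      rw [Section16B.frakp, if_neg h2, Section16B.frakpB]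
      congr 1
      exact tprod_congr fun q => by rw [eM q]
    rw [e1, e2, ← mul_sub, norm_mul, Complex.norm_ofNat]
    calc _ ≤ 2 * (K * (150 * (|Skeleton.b1 c' D| + 2 * ‖s - 1‖) + (D : ℝ) ^ (-(4 / 5 : ℝ)))) := by
          gcongr
      _ ≤ 2 * (K * ((1650 + 75 * |c'|) * π + C8) * (Skeleton.ell D ^ 8)⁻¹) := by gcongr
      _ = 2 * K * ((1650 + 75 * |c'|) * π + C8) * (Skeleton.ell D ^ 8)⁻¹ := by ring

/-- **Lemma 16.1, eventual form over real primitive characters** (the shape of the typed node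
`Typed.Section16B.Lemma161 c′` once `𝔪₂*` is L4-t4's `calM2star`; the idle hypotheses `(A)` and
`dl < PT⁻²` are simply not used). [cite: Zhang2022LandauSiegel, §16 Lemma 16.1 p. 92] -/
theorem lemma161_calM2star (c' : ℝ) : ∃ C : ℝ, Skeleton.ForAllLarge fun D _ χ =>
    Skeleton.AssumptionA D χ → ∀ d l : ℕ, 1 ≤ d → 1 ≤ l →
      ((d * l : ℕ) : ℝ) < Skeleton.bigP D / Skeleton.bigT D ^ 2 →
        ∀ s : ℂ, ‖s - 1‖ < 5 * Skeleton.alpha D →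
          ‖Section16A.calM2star c' χ s - Section16B.frakp χ‖ ≤ C * (Skeleton.ell D ^ 8)⁻¹ := by
  obtain ⟨C, hC⟩ := norm_calM2star_sub_frakp_le c'
  exact ⟨C, ⌈Real.exp 3⌉₊, fun D _ χ hD _ _ _ _ _ _ _ _ s hs => hC D χ hD s hs⟩

/-- **Lemma 16.1 is a theorem**: the typed node `Typed.Section16B.Lemma161 c′` (DAG `Z22:Lem16.1`,
L4-t5's statement with `𝓜₂* = Section16A.calM2star`, `𝔭 = Section16B.frakp`) HOLDS, for every `c′`.
[cite: Zhang2022LandauSiegel, §16 Lemma 16.1 p. 92, App. A p. 105] -/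
theorem lemma161_holds (c' : ℝ) : Section16B.Lemma161 c' := by
  obtain ⟨C, hC⟩ := norm_calM2star_sub_frakp_le c'
  exact ⟨C, ⌈Real.exp 3⌉₊, fun D _ χ hD _ _ _ _ _ _ _ _ s hs => hC D χ hD s hs⟩

variable (c' : ℝ) in
/-- `Lemma161` — `_holds` alias of `lemma161_holds` above under the fact's exact name, stated under the
prover's own binders as section variables (appended 2026-08-28, D-0026 bookkeeping: the proof term is the
existing theorem of this file; no statement, definition or attribute is edited; no new named fact; the
ledger's debt table listed the fact unproved). [cite: Zhang2022LandauSiegel, §16 Lemma 16.1 p. 92, App. A p. 105] -/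
theorem _root_.Literature.NumberTheory.LFunctions.Zhang2022.Typed.Section16B.Lemma161_holds :
    _root_.Literature.NumberTheory.LFunctions.Zhang2022.Typed.Section16B.Lemma161 c' :=
  _root_.Literature.NumberTheory.LFunctions.Zhang2022.AppendixA.lemma161_holds (c' := c')

end LemmaSixteenOne

end Literature.NumberTheory.LFunctions.Zhang2022.AppendixA
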